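import Summits.RiemannHypothesis.RiemannHypothesis.Theorems.JensenPolynomialsSkeletonSound
import Literature.NumberTheory.LFunctions.JensenLaguerreSkeleton
import Literature.Analysis.SpecialFunctions.LaguerreZeros

/-!
# Route `JensenPolynomials` — rung J-P (P1⁺), supports S2/S3: the Laguerre structure of the skeleton and the
# window reduction

**RH-FREE, ξ-free.** For an ARBITRARY real sequence `γ`:

* Appell-frame bookkeeping: `coeff`/`natDegree`/`leadingCoeff`/`eval 0` of `appellPoly r d`, and the reversal identity
  `A^d_r(t) = t^d · J^{d,0}_r(1/t)` (`eval_appellPoly_eq_pow_mul_eval_jensenPoly`);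
* **S2** (`appellPoly_skeletonSeq_eq_comp`, `splits_nodup_appellPoly_skeletonSeq`): with `b = n + ½`, `c = bκ_n`, the Appell
  polynomial of the centred skeleton `s_n` is the `θ_n`-TRANSLATE of `A^d_a`, `a_i = c^i/(b)_i`, and
  `A^d_a(t) = t^d·(d!/(b)_d)·L_d^{(n−½)}(−c/t)` (tree `jensenPoly_pochhammerInv`), so for `κ_n > 0` it has the `d` simple real
  zeros `−θ_n − c/ℓ_i`, `ℓ_i` the (positive, simple) zeros of `L_d^{(n−½)}` (tree `LaguerreZeros`): `Splits ∧ roots.Nodup`;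
* **S3** (`eval_jensenPoly_windowSeq`, `splits_jensenPoly_of_appellPoly_windowSeq`): `J^{d,n}_γ(ρx) = γ(n)·J^{d,0}_{r_n}(x)`,
  `ρ = γ(n)/γ(n+1)`, so for `γ > 0` simple real-rootedness of `appellPoly (windowSeq γ n) d` gives hyperbolicity of `J^{d,n}_γ`.

HOME blueprint: `rh-jensen-theory/JensenTargets.lean` §2 / `THEORY-JENSEN.md` §5 (S2, S3). The ξ-specialisation (strict
Turán ⇒ `κ_n > 0`, the isolation of the ONE sign inequality, G1 and the glue to `TheoremAlpha` / `JensenCubicRangeTwo`)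
is `JensenPolynomialsSkeletonXi`. Nothing here bears on the truth of RH.
-/

noncomputable section
-- D-0017: `Summit.RiemannHypothesis.RiemannHypothesis.…` duplicates the namespace BY DESIGN (single-problem summit).
set_option linter.dupNamespace false

namespace Summit.RiemannHypothesis.RiemannHypothesis.Theorems.JensenPolynomials

open Literature.NumberTheory.LFunctions Polynomial Finset
open Literature.Analysis.SpecialFunctions (laguerre laguerre_eq_C_mul_prod_pos_roots)
open scoped BigOperators Nat

/-! ## Appell-frame bookkeeping -/

/-- Coefficients of the Appell polynomial: `[X^k] A^d_r = C(d, d−k)·r(d−k)` for `k ≤ d`, else `0`. -/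
theorem coeff_appellPoly (r : ℕ → ℝ) (d k : ℕ) :
    (appellPoly r d).coeff k = if k ≤ d then (d.choose (d - k) : ℝ) * r (d - k) else 0 := by
  rw [appellPoly, finsetSum_coeff]
  simp only [coeff_C_mul_X_pow]
  split_ifs with hk
  · rw [Finset.sum_eq_single (d - k)]
    · rw [if_pos (by omega)]
    · intro j hj hne
      rw [if_neg]
      rw [mem_range] at hj
      omega
    · intro h; exact absurd (mem_range.mpr (by omega)) h
  · refine Finset.sum_eq_zero fun j hj => ?_
    rw [if_neg]
    rw [mem_range] at hj
    omega

/-- `deg A^d_r ≤ d`. -/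
theorem natDegree_appellPoly_le (r : ℕ → ℝ) (d : ℕ) : (appellPoly r d).natDegree ≤ d := by
  refine natDegree_le_iff_coeff_eq_zero.2 fun k hk => ?_
  rw [coeff_appellPoly, if_neg (by exact_mod_cast not_le.2 hk)]

/-- The top coefficient of `A^d_r` is `r(0)`. -/
theorem coeff_appellPoly_self (r : ℕ → ℝ) (d : ℕ) : (appellPoly r d).coeff d = r 0 := by
  rw [coeff_appellPoly, if_pos le_rfl, Nat.sub_self, Nat.choose_zero_right, Nat.cast_one, one_mul]

/-- `deg A^d_r = d` when `r(0) ≠ 0`. -/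
theorem natDegree_appellPoly (r : ℕ → ℝ) (d : ℕ) (h : r 0 ≠ 0) : (appellPoly r d).natDegree = d :=
  le_antisymm (natDegree_appellPoly_le r d)
    (le_natDegree_of_ne_zero (by rwa [coeff_appellPoly_self]))

/-- `lc A^d_r = r(0)` when `r(0) ≠ 0`. -/
theorem leadingCoeff_appellPoly (r : ℕ → ℝ) (d : ℕ) (h : r 0 ≠ 0) :
    (appellPoly r d).leadingCoeff = r 0 := by
  rw [leadingCoeff, natDegree_appellPoly r d h, coeff_appellPoly_self]

/-- `A^d_r ≠ 0` when `r(0) ≠ 0`. -/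
theorem appellPoly_ne_zero (r : ℕ → ℝ) (d : ℕ) (h : r 0 ≠ 0) : appellPoly r d ≠ 0 := by
  intro h0
  have := coeff_appellPoly_self r d
  rw [h0, coeff_zero] at this
  exact h this.symm

/-- `A^d_r(0) = r(d)`. -/
theorem eval_zero_appellPoly (r : ℕ → ℝ) (d : ℕ) : (appellPoly r d).eval 0 = r d := by
  rw [← coeff_zero_eq_eval_zero, coeff_appellPoly, if_pos (Nat.zero_le _), Nat.sub_zero, Nat.choose_self,
    Nat.cast_one, one_mul]

/-- **Reversal identity**: for `t ≠ 0`, `A^d_r(t) = t^d · J^{d,0}_r(1/t)` (Appell = reversed Jensen). -/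
theorem eval_appellPoly_eq_pow_mul_eval_jensenPoly (r : ℕ → ℝ) (d : ℕ) {t : ℝ} (ht : t ≠ 0) :
    (appellPoly r d).eval t = t ^ d * (jensenPoly r d 0).eval t⁻¹ := by
  rw [appellPoly, jensenPoly, eval_finsetSum, eval_finsetSum, Finset.mul_sum]
  refine Finset.sum_congr rfl fun j hj => ?_
  have hjd : j ≤ d := Nat.lt_succ_iff.mp (mem_range.mp hj)
  simp only [eval_mul, eval_C, eval_pow, eval_X, zero_add]
  have htj : t ^ j ≠ 0 := pow_ne_zero j ht
  rw [show t ^ d = t ^ (d - j) * t ^ j by rw [← pow_add, Nat.sub_add_cancel hjd], inv_pow]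
  calc (d.choose j : ℝ) * r j * t ^ (d - j)
      = (d.choose j : ℝ) * r j * t ^ (d - j) * (t ^ j * (t ^ j)⁻¹) := by rw [mul_inv_cancel₀ htj, mul_one]
    _ = t ^ (d - j) * t ^ j * ((d.choose j : ℝ) * r j * (t ^ j)⁻¹) := by ring

/-! ## S3: the window reduction -/

/-- `r_n(0) = 1`. -/
theorem windowSeq_zero (γ : ℕ → ℝ) (n : ℕ) (hn : γ n ≠ 0) : windowSeq γ n 0 = 1 := by
  rw [windowSeq]; field_simp; ring

/-- `r_n(2) = γ(n+2)γ(n)/γ(n+1)²`. -/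
theorem windowSeq_two (γ : ℕ → ℝ) (n : ℕ) (hn : γ n ≠ 0) :
    windowSeq γ n 2 = γ (n + 2) * γ n / γ (n + 1) ^ 2 := by
  rw [windowSeq]; field_simp

/-- **S3 (scaling identity)**: `J^{d,0}_{r_n}(x) = γ(n)⁻¹ · J^{d,n}_γ(ρ x)`, `ρ = γ(n)/γ(n+1)`. -/
theorem eval_jensenPoly_windowSeq (γ : ℕ → ℝ) (d n : ℕ) (hn : γ n ≠ 0) (hn1 : γ (n + 1) ≠ 0) (x : ℝ) :
    (jensenPoly (windowSeq γ n) d 0).eval x = (γ n)⁻¹ * (jensenPoly γ d n).eval (γ n / γ (n + 1) * x) := by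
  rw [jensenPoly, jensenPoly, eval_finsetSum, eval_finsetSum, Finset.mul_sum]
  refine Finset.sum_congr rfl fun j _ => ?_
  simp only [eval_mul, eval_C, eval_pow, eval_X, zero_add, windowSeq]
  rw [mul_pow, div_pow]
  field_simp

/-- **S3 (hyperbolicity transfer)**: for a positive sequence `γ`, if `appellPoly (windowSeq γ n) d` splits over `ℝ` with
simple zeros then `J^{d,n}_γ` splits over `ℝ` (its zeros are `ρ/t`, `t` the — nonzero — zeros of the Appell polynomial). -/
theorem splits_jensenPoly_of_appellPoly_windowSeq {γ : ℕ → ℝ} (hpos : ∀ k, 0 < γ k) {d n : ℕ}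
    (hs : (appellPoly (windowSeq γ n) d).Splits) (hnd : (appellPoly (windowSeq γ n) d).roots.Nodup) :
    (jensenPoly γ d n).Splits := by
  classical
  set P := appellPoly (windowSeq γ n) d with hP
  have hr0 : windowSeq γ n 0 ≠ 0 := by rw [windowSeq_zero γ n (hpos n).ne']; exact one_ne_zero
  have hPdeg : P.natDegree = d := natDegree_appellPoly _ d hr0
  obtain ⟨t, ht, hPeval⟩ := exists_strictMono_roots hs hnd hPdeg
  have hProot : ∀ i, P.eval (t i) = 0 := fun i => by
    rw [hPeval]; exact mul_eq_zero_of_right _ (Finset.prod_eq_zero (Finset.mem_univ i) (sub_self _))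
  have ht0 : ∀ i, t i ≠ 0 := by
    intro i h0
    have h1 := hProot i
    rw [h0, hP, eval_zero_appellPoly, windowSeq] at h1
    have h2 : 0 < γ (n + d) * γ n ^ d / (γ n * γ (n + 1) ^ d) := by
      have := hpos (n + d); have := hpos n; have := hpos (n + 1); positivity
    exact h2.ne' h1
  set ρ : ℝ := γ n / γ (n + 1) with hρ
  have hρ0 : ρ ≠ 0 := div_ne_zero (hpos n).ne' (hpos (n + 1)).ne'
  -- the zeros of `J^{d,n}_γ`
  have hroot : ∀ i, (jensenPoly γ d n).eval (ρ * (t i)⁻¹) = 0 := by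
    intro i
    have h1 := eval_jensenPoly_windowSeq γ d n (hpos n).ne' (hpos (n + 1)).ne' (t i)⁻¹
    have h2 := eval_appellPoly_eq_pow_mul_eval_jensenPoly (windowSeq γ n) d (ht0 i)
    rw [← hP, hProot i] at h2
    have h3 : (jensenPoly (windowSeq γ n) d 0).eval (t i)⁻¹ = 0 := by
      rcases mul_eq_zero.mp h2.symm with h | h
      · exact absurd h (pow_ne_zero _ (ht0 i))
      · exact h
    rw [h3] at h1
    rcases mul_eq_zero.mp h1.symm with h | h
    · exact absurd h (inv_ne_zero (hpos n).ne')
    · exact h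
  have hinj : Function.Injective fun i => ρ * (t i)⁻¹ := by
    intro i j hij
    have : (t i)⁻¹ = (t j)⁻¹ := mul_left_cancel₀ hρ0 hij
    exact ht.injective (inv_injective this)
  have hJne : jensenPoly γ d n ≠ 0 := by
    intro h0
    have := natDegree_jensenPoly γ d n (hpos (n + d)).ne'
    rw [h0, natDegree_zero] at this
    -- `d = 0`: then `P` is the constant `r 0 ≠ 0`... but `P` has the root-free degree `0`; either way `J = 0` is absurd:
    have hc := Literature.Analysis.Complex.PolyaSchur.coeff_jensenPoly γ d n d
    rw [h0, coeff_zero, if_pos le_rfl, Nat.choose_self, Nat.cast_one, one_mul] at hc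
    exact (hpos (n + d)).ne' hc.symm
  exact (splits_of_roots hJne (natDegree_jensenPoly γ d n (hpos (n + d)).ne').le _ hinj hroot).1

/-! ## S2: the Laguerre structure of the centred skeleton -/

/-- **Translation identity (real form)** behind S2: for every `a : ℕ → ℝ` and `θ, y`,
`Σ_{j≤d} C(d,j)·(Σ_{i≤j} C(j,i) θ^{j−i} a_i)·y^{d−j} = Σ_{i≤d} C(d,i)·a_i·(y+θ)^{d−i}` — the binomial convolution with
`(θ^j)_j` (EGF `e^{θw}`) acts on Appell polynomials as the translation `X ↦ X + θ`. -/
theorem sum_choose_binomConv_mul_pow (a : ℕ → ℝ) (θ y : ℝ) (d : ℕ) :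
    ∑ j ∈ range (d + 1), (d.choose j : ℝ) * (∑ i ∈ range (j + 1), (j.choose i : ℝ) * θ ^ (j - i) * a i) *
        y ^ (d - j) = ∑ i ∈ range (d + 1), (d.choose i : ℝ) * a i * (y + θ) ^ (d - i) := by
  have hL : ∑ j ∈ range (d + 1), (d.choose j : ℝ) * (∑ i ∈ range (j + 1), (j.choose i : ℝ) * θ ^ (j - i) * a i) *
        y ^ (d - j) = ∑ j ∈ range (d + 1), ∑ i ∈ range (j + 1),
          (d.choose j : ℝ) * (j.choose i : ℝ) * θ ^ (j - i) * a i * y ^ (d - j) := by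
    refine Finset.sum_congr rfl fun j _ => ?_
    rw [Finset.mul_sum, Finset.sum_mul]
    refine Finset.sum_congr rfl fun i _ => ?_
    ring
  rw [hL, Finset.sum_comm' (t' := range (d + 1)) (s' := fun i => Ico i (d + 1))
    (h := fun j i => by simp only [mem_range, mem_Ico]; omega)]
  refine Finset.sum_congr rfl fun i hi => ?_
  have hid : i ≤ d := Nat.lt_succ_iff.mp (mem_range.mp hi)
  rw [Finset.sum_Ico_eq_sum_range, show d + 1 - i = d - i + 1 by omega, add_comm y θ, add_pow,
    Finset.mul_sum]
  refine Finset.sum_congr rfl fun m _ => ?_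
  have e3 : i + m - i = m := by omega
  have e4 : d - (i + m) = d - i - m := by omega
  rw [e3, e4]
  have hc : (d.choose (i + m) : ℝ) * ((i + m).choose i : ℝ) = (d.choose i : ℝ) * ((d - i).choose m : ℝ) := by
    rw [← Nat.cast_mul, ← Nat.cast_mul, Nat.choose_mul (Nat.le_add_right i m), e3]
  calc (d.choose (i + m) : ℝ) * ((i + m).choose i : ℝ) * θ ^ m * a i * y ^ (d - i - m)
      = ((d.choose (i + m) : ℝ) * ((i + m).choose i : ℝ)) * (θ ^ m * a i * y ^ (d - i - m)) := by ring
    _ = ((d.choose i : ℝ) * ((d - i).choose m : ℝ)) * (θ ^ m * a i * y ^ (d - i - m)) := by rw [hc]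
    _ = (d.choose i : ℝ) * a i * (θ ^ m * y ^ (d - i - m) * ((d - i).choose m : ℝ)) := by ring

/-- **Translation identity (polynomial form)**: the Appell polynomial of the binomial convolution of `a` with `(θ^j)_j`
is the `θ`-translate of the Appell polynomial of `a`. -/
theorem appellPoly_binomConv_eq_comp (a : ℕ → ℝ) (θ : ℝ) (d : ℕ) :
    appellPoly (fun j => ∑ i ∈ range (j + 1), (j.choose i : ℝ) * θ ^ (j - i) * a i) d =
      (appellPoly a d).comp (X + C θ) := by
  apply Polynomial.funext
  intro y
  rw [eval_comp, appellPoly, appellPoly, eval_finsetSum, eval_finsetSum]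
  simp only [eval_mul, eval_C, eval_pow, eval_X, eval_add]
  exact sum_choose_binomConv_mul_pow a θ y d

/-- `s_n` is the binomial convolution of `(θ_n^j)_j` with the Bessel sequence `a_i = (bκ_n)^i/(b)_i`, `b = n + ½`
(definitional bookkeeping). -/
theorem skeletonSeq_eq_binomConv (γ : ℕ → ℝ) (n : ℕ) :
    skeletonSeq γ n = fun j => ∑ i ∈ range (j + 1), (j.choose i : ℝ) * skelTheta γ n ^ (j - i) *
      ((((n : ℝ) + 1 / 2) * skelKappa γ n) ^ i / (ascPochhammer ℝ i).eval ((n : ℝ) + 1 / 2)) := by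
  funext j
  rw [skeletonSeq]
  refine Finset.sum_congr rfl fun i _ => ?_
  ring

/-- **S2 (structure)**: the Appell polynomial of the centred skeleton is the `θ_n`-translate of the Appell polynomial of the
Bessel sequence `a_i = (bκ_n)^i/(b)_i`, `b = n + ½`. -/
theorem appellPoly_skeletonSeq_eq_comp (γ : ℕ → ℝ) (n d : ℕ) :
    appellPoly (skeletonSeq γ n) d =
      (appellPoly (fun i => (((n : ℝ) + 1 / 2) * skelKappa γ n) ^ i / (ascPochhammer ℝ i).eval ((n : ℝ) + 1 / 2)) d).comp
        (X + C (skelTheta γ n)) := by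
  rw [skeletonSeq_eq_binomConv]
  exact appellPoly_binomConv_eq_comp _ _ _

/-- `s_n(0) = 1`. -/
theorem skeletonSeq_zero (γ : ℕ → ℝ) (n : ℕ) : skeletonSeq γ n 0 = 1 := by
  simp [skeletonSeq]

/-- **S2 (Laguerre zeros)**: for `b > 0`, `c ≠ 0` and every zero `ℓ > 0` of `L_d^{(b−1)}`, the Appell polynomial of the
Bessel sequence `(c^i/(b)_i)_i` vanishes at `−c/ℓ`; indeed `A^d_a(t) = t^d·(d!/(b)_d)·L_d^{(b−1)}(−c/t)` for `t ≠ 0`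
(tree `jensenPoly_pochhammerInv`). -/
theorem eval_appellPoly_bessel_eq_zero {b c ℓ : ℝ} (hb : 0 < b) (hc : c ≠ 0) (hℓ : 0 < ℓ) (d : ℕ)
    (hroot : (laguerre (b - 1) d).eval ℓ = 0) :
    (appellPoly (fun i => c ^ i / (ascPochhammer ℝ i).eval b) d).eval (-c / ℓ) = 0 := by
  have ht : -c / ℓ ≠ 0 := div_ne_zero (neg_ne_zero.mpr hc) hℓ.ne'
  rw [eval_appellPoly_eq_pow_mul_eval_jensenPoly _ d ht]
  -- `J^{d,0}_a(s) = J^{d,0}_{1/(b)}(c s)` and the tree's Laguerre form of the latter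
  have hscale : ∀ s : ℝ, (jensenPoly (fun i => c ^ i / (ascPochhammer ℝ i).eval b) d 0).eval s =
      (jensenPoly (fun i => 1 / (ascPochhammer ℝ i).eval b) d 0).eval (c * s) := by
    intro s
    rw [jensenPoly, jensenPoly, eval_finsetSum, eval_finsetSum]
    refine Finset.sum_congr rfl fun j _ => ?_
    simp only [eval_mul, eval_C, eval_pow, eval_X, zero_add, mul_pow]
    ring
  rw [hscale, jensenPoly_pochhammerInv hb 1 d 0]
  simp only [Nat.cast_zero, add_zero, eval_mul, eval_C, eval_comp, eval_neg, eval_X]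
  rw [show -(c * (-c / ℓ)⁻¹) = ℓ by field_simp, hroot]
  ring

/-- **S2 (RH-FREE, ξ-free): the centred skeleton is hyperbolic with simple zeros.** For every real sequence `γ` and shift
`n` with `κ_n > 0`, `appellPoly (skeletonSeq γ n) d` splits over `ℝ`, has `d` simple zeros (namely `−θ_n − bκ_n/ℓ_i`, `ℓ_i`
the zeros of `L_d^{(n−½)}`) and degree `d`. (THEORY-JENSEN §5 S2; the DATA evaluators of record took exactly this
structure for granted once `κ² > 0` was certified — here it is a kernel theorem.) -/
theorem splits_nodup_appellPoly_skeletonSeq (γ : ℕ → ℝ) (n d : ℕ) (hκ : 0 < skelKappa γ n) :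
    (appellPoly (skeletonSeq γ n) d).Splits ∧ (appellPoly (skeletonSeq γ n) d).roots.Nodup ∧
      (appellPoly (skeletonSeq γ n) d).natDegree = d := by
  classical
  set b : ℝ := (n : ℝ) + 1 / 2 with hbdef
  have hb : 0 < b := by rw [hbdef]; positivity
  set c : ℝ := b * skelKappa γ n with hcdef
  have hc : c ≠ 0 := (mul_pos hb hκ).ne'
  set θ : ℝ := skelTheta γ n with hθ
  set Q := appellPoly (skeletonSeq γ n) d with hQ
  have hα : (-1 : ℝ) < b - 1 := by rw [hbdef]; linarith [(Nat.cast_nonneg n : (0 : ℝ) ≤ n)]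
  obtain ⟨ℓ, hℓmono, hℓpos, hL⟩ := laguerre_eq_C_mul_prod_pos_roots hα d
  have hLroot : ∀ i, (laguerre (b - 1) d).eval (ℓ i) = 0 := fun i => by
    rw [hL, eval_mul, eval_prod]
    exact mul_eq_zero_of_right _ (Finset.prod_eq_zero (Finset.mem_univ i) (by simp))
  -- the `d` zeros of `Q`
  have hQroot : ∀ i, Q.eval (-c / ℓ i - θ) = 0 := by
    intro i
    rw [hQ, appellPoly_skeletonSeq_eq_comp, eval_comp, eval_add, eval_X, eval_C, ← hθ, sub_add_cancel]
    exact eval_appellPoly_bessel_eq_zero hb hc (hℓpos i) d (hLroot i)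
  have hinj : Function.Injective fun i => -c / ℓ i - θ := by
    intro i j hij
    have h1 : -c / ℓ i = -c / ℓ j := by simpa using hij
    rw [div_eq_div_iff (hℓpos i).ne' (hℓpos j).ne'] at h1
    have h2 : ℓ j = ℓ i := mul_left_cancel₀ (neg_ne_zero.mpr hc) h1
    exact hℓmono.injective h2.symm
  have hs0 : skeletonSeq γ n 0 ≠ 0 := by rw [skeletonSeq_zero]; exact one_ne_zero
  have hQne : Q ≠ 0 := appellPoly_ne_zero _ d hs0
  obtain ⟨hsplit, hdeg, hroots⟩ := splits_of_roots hQne (natDegree_appellPoly_le _ d) _ hinj hQroot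
  exact ⟨hsplit, hroots ▸ Multiset.Nodup.map hinj Finset.univ.nodup, hdeg⟩

end Summit.RiemannHypothesis.RiemannHypothesis.Theorems.JensenPolynomials

end
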